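import Mathlib
import Summits.ValiantsHypothesis.ValiantsHypothesis.Theorems.RigidityForcesSymmetryRankRigidMinimalReprLaplaceContract

/-!
# Every cheap split-rank-one decomposition of `P₅` satisfies the five slot-contraction inequalities
# (crux `RankRigidMinimalRepr`, stmt-ValiantsHypothesis-18034; frontier rung `LaplaceOptimalFive`, stmt-24813)

The official-format consequence of `LaplaceContract.contract` (`…LaplaceContract.lean`) with the landed `laplaceOptimal_four`,
valid for EVERY decomposition of the `5 × 5` permutation pattern of total Laplace weight `< 120` (so in particular for every
one of the 1 618 maximal cheap profiles of the programme, not only the `a = 3` class):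

* `laplace_five_slot_contraction` — for every slot `s`, the terms that are NOT slices at `s` (`S_t ∉ {{s}, {s}ᶜ}`) satisfy
  `24 ≤ Σ_t c_t! (4 - c_t)!` with `c_t = |S_t| - [s ∈ S_t]` — i.e. a slice at another slot or a pair term with `s` on its
  2-slot side counts `6`, a pair term with `s` on its 3-slot side counts `4` (a trivial term counts `24`).  Proof: the slices at
  `s` are at most four (each weighs `24`), so a non-zero covector orthogonal to their vectors exists and kills them in the
  contraction of slot `s`.

By enumeration (evidence of p8 g11 on stmt-24813) these five inequalities exclude 129 of the 1 618 maximal cheap profiles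
(all 16 with four slices, 67 of 107 with three, 46 of 350 with two, none with `≤ 1` slice) — a structural constraint, not a
proof of the rung.  No definitions.  HONEST FRAMING: an exact partial result toward the frontier rung `LaplaceOptimalFive`
(stmt-24813), which stays OPEN; nothing here bears on `VP ≠ VNP`, which is NOT proved.
-/

set_option autoImplicit false

-- the mandated summit-side namespace repeats a component by design (single-problem summit)
set_option linter.dupNamespace false

namespace Summit.ValiantsHypothesis.ValiantsHypothesis.Theorems.RigidityForcesSymmetryRankRigidMinimalRepr

namespace LaplaceContract

open Finset

/-- **Slot contraction for cheap decompositions of `P₅`.**  In the data format of `LaplaceOptimal 5`: if the terms sum to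
`[v injective]` with total Laplace weight `< 120`, then for every slot `s` the terms other than the slices at `s` satisfy
`24 ≤ Σ_t c_t! (4 - c_t)!`, `c_t = |S_t| - [s ∈ S_t]`. -/
theorem laplace_five_slot_contraction {N : ℕ} (T : Finset (Fin N)) (S : Fin N → Finset (Fin 5))
    (u w : Fin N → (Fin 5 → Fin 5) → ℂ)
    (hu : ∀ t, ∀ v v' : Fin 5 → Fin 5, (∀ i ∈ S t, v i = v' i) → u t v = u t v')
    (hw : ∀ t, ∀ v v' : Fin 5 → Fin 5, (∀ i, i ∉ S t → v i = v' i) → w t v = w t v')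
    (hsum : ∀ v : Fin 5 → Fin 5, (∑ t ∈ T, u t v * w t v) = if Function.Injective v then 1 else 0)
    (hlt : ∑ t ∈ T, (S t).card.factorial * (5 - (S t).card).factorial < 120) (s : Fin 5) :
    24 ≤ ∑ t ∈ T.filter (fun t => ¬ (S t = {s} ∨ S t = {s}ᶜ)),
      ((S t).card - (if s ∈ S t then 1 else 0)).factorial * (4 - ((S t).card - (if s ∈ S t then 1 else 0))).factorial := by
  classical
  -- the slices at `s`: at most four of them
  set K := T.filter (fun t => S t = {s} ∨ S t = {s}ᶜ) with hK
  have hKT : K ⊆ T := filter_subset _ _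
  have hKw : ∀ t ∈ K, (S t).card.factorial * (5 - (S t).card).factorial = 24 := by
    intro t ht
    rw [hK, mem_filter] at ht
    rcases ht.2 with h | h
    · rw [h, card_singleton]; decide
    · rw [h, card_compl, Fintype.card_fin, card_singleton]; decide
  have hKcard : K.card < 5 := by
    have h1 : ∑ t ∈ K, (S t).card.factorial * (5 - (S t).card).factorial ≤
        ∑ t ∈ T, (S t).card.factorial * (5 - (S t).card).factorial :=
      sum_le_sum_of_subset_of_nonneg hKT (fun _ _ _ => Nat.zero_le _)
    rw [sum_congr rfl hKw, sum_const, smul_eq_mul] at h1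
    omega
  -- the slice vectors at `s` and a covector orthogonal to them
  let vec : Fin N → (Fin 5 → ℂ) := fun t c =>
    if S t = {s} then u t (Function.update (fun _ => (0 : Fin 5)) s c) else w t (Function.update (fun _ => (0 : Fin 5)) s c)
  obtain ⟨lam, hlam0, hlam⟩ := LaplaceTriangular.exists_ne_zero_orthogonal (K.image vec)
    (lt_of_le_of_lt card_image_le hKcard)
  obtain ⟨a, ha⟩ : ∃ a, lam a ≠ 0 := by by_contra h; push Not at h; exact hlam0 (funext h)
  -- the kills
  have hkill : ∀ t ∈ K, (s ∈ S t ∧ ∀ v : Fin 5 → Fin 5, ∑ c, lam c * u t (Function.update v s c) = 0) ∨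
      (s ∉ S t ∧ ∀ v : Fin 5 → Fin 5, ∑ c, lam c * w t (Function.update v s c) = 0) := by
    intro t ht
    have horth := hlam (vec t) (mem_image_of_mem _ ht)
    rw [hK, mem_filter] at ht
    rcases ht.2 with h | h
    · left
      refine ⟨by rw [h]; exact mem_singleton_self s, fun v => ?_⟩
      have : ∀ c, u t (Function.update v s c) = vec t c := by
        intro c
        simp only [vec, if_pos h]
        refine hu t _ _ (fun i hi => ?_)
        rw [h, mem_singleton] at hi
        rw [hi, Function.update_self, Function.update_self]
      simp only [this]; exact horth
    · right
      have hs : s ∉ S t := by rw [h, mem_compl]; exact fun hn => hn (mem_singleton_self s)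
      have hne : S t ≠ {s} := by intro e; rw [e] at hs; exact hs (mem_singleton_self s)
      refine ⟨hs, fun v => ?_⟩
      have : ∀ c, w t (Function.update v s c) = vec t c := by
        intro c
        simp only [vec, if_neg hne]
        refine hw t _ _ (fun i hi => ?_)
        rw [h, mem_compl, not_not, mem_singleton] at hi
        rw [hi, Function.update_self, Function.update_self]
      simp only [this]; exact horth
  have hb := contract (d := 4) laplaceOptimal_four T S u w hu hw hsum s a lam ha K hKT hkill
  -- evaluate the restricted split sizes
  have hsd : T \ K = T.filter (fun t => ¬ (S t = {s} ∨ S t = {s}ᶜ)) := by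
    rw [hK, ← filter_not]
  have hc : ∀ t, (univ.filter (fun k : Fin 4 => s.succAbove k ∈ S t)).card = (S t).card - (if s ∈ S t then 1 else 0) := by
    intro t
    have := LaplaceRestrict.card_eq s (S t)
    omega
  have h24 : (4 : ℕ).factorial = 24 := rfl
  rw [h24, hsd] at hb
  simp only [hc] at hb
  exact hb

end LaplaceContract

end Summit.ValiantsHypothesis.ValiantsHypothesis.Theorems.RigidityForcesSymmetryRankRigidMinimalRepr
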